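import Summits.AtomisticToContinuum.Crystallization.Theorems.FrustratedLawDichotomyStrainedPatchGradedStage

/-!
# TableFloors — LP-FREE FLOORS under the stage tables of `GradStep` / `GradedStage` (lens-5 g79, «finite/base range + asymptotic regime + bridge»)

TARGET OF RECORD (27623 T-leaf) `CoreOffTubeFloor (63/10) (63/10) (24/5) (1/100) 0` **[CORE-FAR]**, through the g76–g78 row-priced descent whose
every stage is certified by FIRST-DIFFERENCE / PAIR TABLES `G, G₁, G₂` — suprema of linear objectives over the GLOBAL (graded) row polytope
{`D` : `‖D h‖ ≤ τ` (and `≤ T(h)`) on `O`, `D c₀ = 0`, `‖hostLin(j)‖ ≤ σ + Y(j)` at the SURE-reach rows `j`} — each an LP/SOCP in `3|O| ≈ 4 800`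
variables (census reading ④′ GRAD-77, not yet run; critic rows 1269 / 1275 / 1280).

THIS MODULE TYPES THE OTHER BRACKET.  Any explicit field `D` IN the polytope is a PRIMAL WITNESS: every valid table satisfies `G(h, h′) ≥ ‖D h′ − D h‖`.
For a field supported on a finite set `S` (`|S| ≤ 3` in practice) membership in the polytope is a CLOSED-FORM ROW CHECK — `|S|` matrix–vector
products per sure-reach row, no optimisation — so the census obtains, at zero LP cost and with interval-certifiable arithmetic, a FLOOR under
every stage table, hence (by the monotone evaluation) under every certified stage PRICE, hence under the descent's fixed point:

* §1 `AdmOcc` (the occupancy clauses of `HostReading`), the finitely-supported WITNESS FIELD `pinField S u`, its linear rows in closed form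
  ★ `hostLin_pinField` and its (graded) admissibility [formal bookkeeping].
* §2 ★ `WitnessFeasible` [INSTRUMENTABLE · closed form] and the FLOORS ★★ `diffTab_floor`, ★★ `pairTab_floor` under `HostDiffTab` / `HostPairTab`
  (g76, tree) and ★★ `diffTabG_floor`, ★★ `pairTabG_floor` under `HostDiffTabG` / `HostPairTabG` (g78); column monotonicity ★ `WitnessFeasible.mono` /
  `.addCol`: a witness feasible against the BARE column `σ + X` is feasible against EVERY priced column `σ + X + P_i`, `P_i ≥ 0` — ONE row check
  floors EVERY stage of EVERY descent.
* §3 THE DIPOLE `dipole h h′ a b` (`D h = a`, `D h′ = b`, zero elsewhere): ★ `DipoleFeasible` [INSTRUMENTABLE · two matrix–vector products per row],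
  ★★★ `diffTab_dipole_floor` / `diffTabG_dipole_floor` (`‖b − a‖ ≤ G(h, h′)`), and ★★★ STUCK-AT-THE-BOX `boxTab_le_of_dipoleFeasible` /
  `boxTabG_le_of_dipoleFeasible`: if the full-amplitude antiparallel dipole `(−T(h)·e, +T(h′)·e)` passes the row check, NO valid table beats the
  (graded) box at `(h, h′)` — the stage is provably stuck there, whatever the LP.
* §4 THE PRICE FLOOR: `diffEval` is monotone in the table [PROVED, `diffEval_mono`], so a certified evaluation `DiffEvalTab(G) ≤ P` and an entrywise
  floor `Gf ≤ G` on the near sets give ★★ `diffEval_floor_le_price`: `diffEval(Gf)(h) ≤ P(h)`.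
* SEQUEL MODULE `…StrainedPatchTableFloorChain` (§5–§6, same namespace): ★★★ THE FLOOR CHAIN `floorChain_le_prices` / `stageChainG_floor_le_prices`
  [PROVED · induction on the stage]: floor prices generated by witnesses feasible against the FLOOR columns `σ + X + Pf i` satisfy `Pf i ≤ P i` along
  EVERY certified chain — in the (HDIFF)/(DEVAL) format and in the RECORD format (graded pair-table stages `StageCertG` of g78's
  `coreOff_record_of_gradeTol_pairTabs`; g76's `StageCert` at `T = constTol τ`): the census's LP-free FLOOR ITERATION (memo NODE-g79 §2–§3, reading
  DIP-79) lower-bounds every certified stage price and the descent's fixed point, cell by cell, before any LP is run.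

Numbers (memo §1, HZ00 of record): the on-site stiffness `K_E = Σ_{0<‖x‖≤7} ∇²V(x)` has eigenvalues `34.45 / 39.44 / 44.67`; the transverse
dipole's binding row cost is `κ_dip ∈ [34.2, 37.9]` per unit amplitude, against the stage-1 column `σ₁ + X + P₀ ≈ 0.276` at `T = 1/100`: the
dipole floor is `g₁ ≥ 0.81` at inner rows, `≥ 0.99` at `X = 6σ₁`, and `= 1` (STUCK) at `τ = 1/80` for every row.  Every theorem below is formal
bookkeeping over the g73/g75/g76/g78 host objects; the module asserts nothing about the summit or the T-leaf — it prices the census's decision.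
-/

namespace Summit.AtomisticToContinuum.Crystallization.Theorems.FrustratedLawDichotomyStrainedPatchTableFloors

open scoped BigOperators Classical RealInnerProductSpace
open Summit.AtomisticToContinuum.Crystallization.Theorems.FrustratedLawDichotomyMotifLemmas
open Summit.AtomisticToContinuum.Crystallization.Theorems.FrustratedLawDichotomyRangeCut
open Summit.AtomisticToContinuum.Crystallization.Theorems.FrustratedLawDichotomyAveragingCut
open Summit.AtomisticToContinuum.Crystallization.Theorems.FrustratedLawDichotomyStrainedPatchHomSplit
open Summit.AtomisticToContinuum.Crystallization.Theorems.FrustratedLawDichotomyStrainedPatchQuantSlaving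
open Summit.AtomisticToContinuum.Crystallization.Theorems.FrustratedLawDichotomyStrainedPatchHostCells
open Summit.AtomisticToContinuum.Crystallization.Theorems.FrustratedLawDichotomyStrainedPatchHostStep
open Summit.AtomisticToContinuum.Crystallization.Theorems.FrustratedLawDichotomyStrainedPatchRowPrice
open Summit.AtomisticToContinuum.Crystallization.Theorems.FrustratedLawDichotomyStrainedPatchGradStep
open Summit.AtomisticToContinuum.Crystallization.Theorems.FrustratedLawDichotomyStrainedPatchGradedTube
open Summit.AtomisticToContinuum.Crystallization.Theorems.FrustratedLawDichotomyStrainedPatchGradedDescent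
open Summit.AtomisticToContinuum.Crystallization.Theorems.FrustratedLawDichotomyStrainedPatchGradedStage

/-! ## §1. Admissible occupancies, finitely-supported witness fields, their linear rows in closed form -/

/-- An ADMISSIBLE OCCUPANCY: the three occupancy clauses of `HostReading` (contains the centre and every host site within `63/10 − τ` of it, lies
within `63/10 + τ`). [DECIDABLE bookkeeping per host] -/
def AdmOcc (τ : ℝ) {M₀ : ℕ} (z₀ : Fin M₀ → E3) (c₀ : Fin M₀) (O : Finset (Fin M₀)) : Prop :=
  c₀ ∈ O ∧ (∀ h, dist (z₀ h) (z₀ c₀) ≤ 63 / 10 - τ → h ∈ O) ∧ ∀ h ∈ O, dist (z₀ h) (z₀ c₀) ≤ 63 / 10 + τ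

/-- The WITNESS FIELD supported on `S` with values `u` (zero off `S`). -/
def pinField {M₀ : ℕ} (S : Finset (Fin M₀)) (u : Fin M₀ → E3) : Fin M₀ → E3 := fun k => if k ∈ S then u k else 0

section Witness

variable {τ σ r : ℝ} {H : HessTab} {F : ForceTab} {T : SlackTab} {M₀ : ℕ} {z₀ : Fin M₀ → E3} {c₀ : Fin M₀} {O S : Finset (Fin M₀)} {D u : Fin M₀ → E3}

/-- A host reading has an admissible occupancy. [formal bookkeeping] -/
theorem admOcc_of_hostReading (h : HostReading τ z₀ c₀ O D) : AdmOcc τ z₀ c₀ O := ⟨h.1, h.2.1, h.2.2.1⟩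

/-- `HostReading` = admissible occupancy + box + centre pin. [formal bookkeeping] -/
theorem hostReading_iff : HostReading τ z₀ c₀ O D ↔ AdmOcc τ z₀ c₀ O ∧ (∀ h ∈ O, ‖D h‖ ≤ τ) ∧ D c₀ = 0 :=
  ⟨fun h => ⟨⟨h.1, h.2.1, h.2.2.1⟩, h.2.2.2.1, h.2.2.2.2⟩, fun h => ⟨h.1.1, h.1.2.1, h.1.2.2, h.2.1, h.2.2⟩⟩

/-- On the support the witness field is `u`. [formal bookkeeping] -/
theorem pinField_of_mem {k : Fin M₀} (hk : k ∈ S) : pinField S u k = u k := if_pos hk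

/-- Off the support the witness field vanishes. [formal bookkeeping] -/
theorem pinField_of_not_mem {k : Fin M₀} (hk : k ∉ S) : pinField S u k = 0 := if_neg hk

/-- ★ THE LINEAR ROWS OF A WITNESS FIELD IN CLOSED FORM: `hostLin(j) = F(j) + Σ_{k ∈ S} H(j, k)(u k)` for `S ⊆ O` — `|S|` matrix–vector products per row.
[formal bookkeeping: the sum over `O` collapses to `S`] -/
theorem hostLin_pinField (hS : S ⊆ O) (j : Fin M₀) :
    hostLin H F z₀ c₀ O (pinField S u) j = F M₀ z₀ c₀ j + ∑ k ∈ S, H M₀ z₀ c₀ j k (u k) := by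
  have h₁ : ∑ k ∈ O, H M₀ z₀ c₀ j k (pinField S u k) = ∑ k ∈ S, H M₀ z₀ c₀ j k (pinField S u k) :=
    (Finset.sum_subset hS fun k _ hk => by rw [pinField_of_not_mem hk, map_zero]).symm
  have h₂ : ∑ k ∈ S, H M₀ z₀ c₀ j k (pinField S u k) = ∑ k ∈ S, H M₀ z₀ c₀ j k (u k) :=
    Finset.sum_congr rfl fun k hk => by rw [pinField_of_mem hk]
  rw [hostLin, h₁, h₂]

/-- A witness field off the centre with values in the `τ`-box is an admissible host READING on any admissible occupancy. [formal bookkeeping] -/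
theorem hostReading_pinField (hO : AdmOcc τ z₀ c₀ O) (hc : c₀ ∉ S) (hτ : 0 ≤ τ) (hu : ∀ k ∈ S, ‖u k‖ ≤ τ) :
    HostReading τ z₀ c₀ O (pinField S u) := by
  refine ⟨hO.1, hO.2.1, hO.2.2, fun k _ => ?_, pinField_of_not_mem hc⟩
  by_cases hkS : k ∈ S
  · rw [pinField_of_mem hkS]; exact hu k hkS
  · rw [pinField_of_not_mem hkS, norm_zero]; exact hτ

/-- … and a GRADED reading when the values are also in the per-site boxes `T(k)` and `T ≥ 0` on the occupancy. [formal bookkeeping] -/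
theorem hostReadingG_pinField (hO : AdmOcc τ z₀ c₀ O) (hc : c₀ ∉ S) (hτ : 0 ≤ τ) (hu : ∀ k ∈ S, ‖u k‖ ≤ τ) (hT : ∀ k ∈ O, 0 ≤ T M₀ z₀ c₀ k)
    (huT : ∀ k ∈ S, ‖u k‖ ≤ T M₀ z₀ c₀ k) : HostReadingG τ T z₀ c₀ O (pinField S u) := by
  refine ⟨hostReading_pinField hO hc hτ hu, fun k hk => ?_⟩
  by_cases hkS : k ∈ S
  · rw [pinField_of_mem hkS]; exact huT k hkS
  · rw [pinField_of_not_mem hkS, norm_zero]; exact hT k hk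

/-- The ZERO field is an admissible host reading on any admissible occupancy (`0 ≤ τ`). [formal bookkeeping] -/
theorem hostReading_zero (hO : AdmOcc τ z₀ c₀ O) (hτ : 0 ≤ τ) : HostReading τ z₀ c₀ O (fun _ => 0) :=
  ⟨hO.1, hO.2.1, hO.2.2, fun _ _ => by rw [norm_zero]; exact hτ, rfl⟩

/-- A sure-reach row is a maybe-reach row (`0 ≤ τ`). [formal bookkeeping] -/
theorem hostMaybeReach_of_sureReach {j : Fin M₀} (hτ : 0 ≤ τ) (h : HostSureReach τ z₀ c₀ O j) : HostMaybeReach τ z₀ c₀ O j := by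
  obtain ⟨j₀, hj₀, h₁, h₂⟩ := h
  exact ⟨j₀, hj₀, by linarith, by linarith⟩

end Witness

/-! ## §2. Witness feasibility (closed-form row check) and the table floors -/

/-- ★ **(WFEAS) `WitnessFeasible τ σ H F Y z₀ c₀ O S u`** [INSTRUMENTABLE · CLOSED FORM — `|S|` matrix–vector products per sure-reach row, no LP]: the
witness field `pinField S u` passes the polytope rows `‖F(j) + Σ_{k ∈ S} H(j, k)(u k)‖ ≤ σ + Y(j)` at every SURE-reach row `j ∈ O`. -/
def WitnessFeasible (τ σ : ℝ) (H : HessTab) (F : ForceTab) (Y : SlackTab) {M₀ : ℕ} (z₀ : Fin M₀ → E3) (c₀ : Fin M₀) (O S : Finset (Fin M₀))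
    (u : Fin M₀ → E3) : Prop :=
  ∀ j ∈ O, HostSureReach τ z₀ c₀ O j → ‖F M₀ z₀ c₀ j + ∑ k ∈ S, H M₀ z₀ c₀ j k (u k)‖ ≤ σ + Y M₀ z₀ c₀ j

section Floors

variable {𝓘 : ChartFam} {τ σ r : ℝ} {H : HessTab} {F : ForceTab} {X Y Y' P T : SlackTab} {Pm : PairMap} {G G₁ G₂ : DiffTab} {M₀ : ℕ}
  {z₀ : Fin M₀ → E3} {c₀ : Fin M₀} {O S : Finset (Fin M₀)} {u : Fin M₀ → E3}

/-- A feasible witness satisfies the polytope rows of the table formats. [formal bookkeeping: `hostLin_pinField`] -/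
theorem WitnessFeasible.rows (hS : S ⊆ O) (h : WitnessFeasible τ σ H F Y z₀ c₀ O S u) :
    ∀ j ∈ O, HostSureReach τ z₀ c₀ O j → ‖hostLin H F z₀ c₀ O (pinField S u) j‖ ≤ σ + Y M₀ z₀ c₀ j :=
  fun j hj hs => by rw [hostLin_pinField hS]; exact h j hj hs

/-- ★ COLUMN MONOTONICITY: feasible against a column is feasible against any column at least as large at the sure-reach rows of `O`.
[formal bookkeeping] -/
theorem WitnessFeasible.mono (hY : ∀ j ∈ O, HostSureReach τ z₀ c₀ O j → Y M₀ z₀ c₀ j ≤ Y' M₀ z₀ c₀ j)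
    (h : WitnessFeasible τ σ H F Y z₀ c₀ O S u) : WitnessFeasible τ σ H F Y' z₀ c₀ O S u :=
  fun j hj hs => (h j hj hs).trans (by linarith [hY j hj hs])

/-- ★ Hence a witness feasible against the BARE column `σ + X` is feasible against EVERY priced column `σ + X + P`, `P ≥ 0`: one row check floors
every stage of every descent. [formal bookkeeping] -/
theorem WitnessFeasible.addCol (hP : ∀ j, 0 ≤ P M₀ z₀ c₀ j) (h : WitnessFeasible τ σ H F X z₀ c₀ O S u) :
    WitnessFeasible τ σ H F (FrustratedLawDichotomyStrainedPatchRowPrice.addCol X P) z₀ c₀ O S u :=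
  h.mono fun j _ _ => by simp only [FrustratedLawDichotomyStrainedPatchRowPrice.addCol]; linarith [hP j]

/-- ★★ **THE DIFFERENCE-TABLE FLOOR** — a feasible witness in the `τ`-box, off the centre, on an admissible occupancy of an instance bounds EVERY
valid (HDIFF) table from below: `‖D h′ − D h‖ ≤ G(h, h′)` at every maybe-reach row and near partner. [formal bookkeeping: instantiate (HDIFF)] -/
theorem diffTab_floor (hG : HostDiffTab 𝓘 τ σ r H F Y G) (hI : 𝓘 M₀ z₀ c₀) (hO : AdmOcc τ z₀ c₀ O) (hS : S ⊆ O) (hc : c₀ ∉ S) (hτ : 0 ≤ τ)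
    (hu : ∀ k ∈ S, ‖u k‖ ≤ τ) (hW : WitnessFeasible τ σ H F Y z₀ c₀ O S u) {h : Fin M₀} (hh : h ∈ O) (hm : HostMaybeReach τ z₀ c₀ O h)
    {h' : Fin M₀} (hh' : h' ∈ hostNear r z₀ O h) : ‖pinField S u h' - pinField S u h‖ ≤ G M₀ z₀ c₀ h h' :=
  hG M₀ z₀ c₀ hI O (pinField S u) (hostReading_pinField hO hc hτ hu) (hW.rows hS) h hh hm h' hh'

/-- ★★ **THE PAIR-TABLE FLOORS** — the same witness bounds the across-pair and second-difference tables of (HPAIR) from below. [formal bookkeeping] -/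
theorem pairTab_floor (hG : HostPairTab 𝓘 τ σ r H F Y Pm G₁ G₂) (hI : 𝓘 M₀ z₀ c₀) (hO : AdmOcc τ z₀ c₀ O) (hS : S ⊆ O) (hc : c₀ ∉ S) (hτ : 0 ≤ τ)
    (hu : ∀ k ∈ S, ‖u k‖ ≤ τ) (hW : WitnessFeasible τ σ H F Y z₀ c₀ O S u) {h : Fin M₀} (hh : h ∈ O) (hm : HostMaybeReach τ z₀ c₀ O h)
    {h' : Fin M₀} (hh' : h' ∈ hostNear r z₀ O h) :
    ‖pinField S u h' - pinField S u (Pm M₀ z₀ c₀ O h h')‖ ≤ G₁ M₀ z₀ c₀ h h' ∧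
      ‖pinField S u h' + pinField S u (Pm M₀ z₀ c₀ O h h') - (2 : ℝ) • pinField S u h‖ ≤ G₂ M₀ z₀ c₀ h h' :=
  hG M₀ z₀ c₀ hI O (pinField S u) (hostReading_pinField hO hc hτ hu) (hW.rows hS) h hh hm h' hh'

/-- ★★ **THE GRADED DIFFERENCE-TABLE FLOOR** (under (HDIFF-G) of `GradedStage`): as `diffTab_floor`, the witness also in the per-site boxes `T ≥ 0`.
[formal bookkeeping] -/
theorem diffTabG_floor (hG : HostDiffTabG 𝓘 τ T σ r H F Y G) (hI : 𝓘 M₀ z₀ c₀) (hO : AdmOcc τ z₀ c₀ O) (hS : S ⊆ O) (hc : c₀ ∉ S) (hτ : 0 ≤ τ)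
    (hu : ∀ k ∈ S, ‖u k‖ ≤ τ) (hT : ∀ k ∈ O, 0 ≤ T M₀ z₀ c₀ k) (huT : ∀ k ∈ S, ‖u k‖ ≤ T M₀ z₀ c₀ k) (hW : WitnessFeasible τ σ H F Y z₀ c₀ O S u)
    {h : Fin M₀} (hh : h ∈ O) (hm : HostMaybeReach τ z₀ c₀ O h) {h' : Fin M₀} (hh' : h' ∈ hostNear r z₀ O h) :
    ‖pinField S u h' - pinField S u h‖ ≤ G M₀ z₀ c₀ h h' :=
  hG M₀ z₀ c₀ hI O (pinField S u) (hostReadingG_pinField hO hc hτ hu hT huT) (hW.rows hS) h hh hm h' hh'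

/-- ★★ **THE GRADED PAIR-TABLE FLOORS** (under (HPAIR-G)). [formal bookkeeping] -/
theorem pairTabG_floor (hG : HostPairTabG 𝓘 τ T σ r H F Y Pm G₁ G₂) (hI : 𝓘 M₀ z₀ c₀) (hO : AdmOcc τ z₀ c₀ O) (hS : S ⊆ O) (hc : c₀ ∉ S)
    (hτ : 0 ≤ τ) (hu : ∀ k ∈ S, ‖u k‖ ≤ τ) (hT : ∀ k ∈ O, 0 ≤ T M₀ z₀ c₀ k) (huT : ∀ k ∈ S, ‖u k‖ ≤ T M₀ z₀ c₀ k)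
    (hW : WitnessFeasible τ σ H F Y z₀ c₀ O S u) {h : Fin M₀} (hh : h ∈ O) (hm : HostMaybeReach τ z₀ c₀ O h) {h' : Fin M₀}
    (hh' : h' ∈ hostNear r z₀ O h) :
    ‖pinField S u h' - pinField S u (Pm M₀ z₀ c₀ O h h')‖ ≤ G₁ M₀ z₀ c₀ h h' ∧
      ‖pinField S u h' + pinField S u (Pm M₀ z₀ c₀ O h h') - (2 : ℝ) • pinField S u h‖ ≤ G₂ M₀ z₀ c₀ h h' :=
  hG M₀ z₀ c₀ hI O (pinField S u) (hostReadingG_pinField hO hc hτ hu hT huT) (hW.rows hS) h hh hm h' hh'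

end Floors

/-! ## §3. The dipole: closed-form feasibility, the dipole floor, STUCK-AT-THE-BOX -/

/-- THE DIPOLE FIELD: `D h = a`, `D h′ = b`, zero elsewhere. -/
def dipole {M₀ : ℕ} (h h' : Fin M₀) (a b : E3) : Fin M₀ → E3 := pinField {h, h'} (fun k => if k = h' then b else a)

/-- ★ **(DFEAS) `DipoleFeasible τ σ H F Y z₀ c₀ O h h′ a b`** [INSTRUMENTABLE · CLOSED FORM — two matrix–vector products per sure-reach row]: the dipole
passes the polytope rows `‖F(j) + H(j, h) a + H(j, h′) b‖ ≤ σ + Y(j)` at every SURE-reach row `j ∈ O` (with `H = hessBlk0`: row `h` reads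
`‖F(h) − K_E(h) a + ∇²V(z₀ h − z₀ h′) b‖`, `K_E(h) = Σ_{0<‖x‖≤7} ∇²V(x)` the on-site stiffness; third-party rows read `‖F(j) + ∇²V(x_{jh}) a + ∇²V(x_{jh′}) b‖`). -/
def DipoleFeasible (τ σ : ℝ) (H : HessTab) (F : ForceTab) (Y : SlackTab) {M₀ : ℕ} (z₀ : Fin M₀ → E3) (c₀ : Fin M₀) (O : Finset (Fin M₀))
    (h h' : Fin M₀) (a b : E3) : Prop :=
  ∀ j ∈ O, HostSureReach τ z₀ c₀ O j → ‖F M₀ z₀ c₀ j + H M₀ z₀ c₀ j h a + H M₀ z₀ c₀ j h' b‖ ≤ σ + Y M₀ z₀ c₀ j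

section Dipole

variable {𝓘 : ChartFam} {τ σ r : ℝ} {H : HessTab} {F : ForceTab} {X Y P T : SlackTab} {Pm : PairMap} {G G₁ G₂ : DiffTab} {M₀ : ℕ} {z₀ : Fin M₀ → E3}
  {c₀ : Fin M₀} {O : Finset (Fin M₀)} {h h' : Fin M₀} {a b e : E3}

/-- `dipole h h′ a b h′ = b`. [formal bookkeeping] -/
theorem dipole_right : dipole h h' a b h' = b := by
  rw [dipole, pinField_of_mem (Finset.mem_insert_of_mem (Finset.mem_singleton_self h'))]; exact if_pos rfl

/-- `dipole h h′ a b h = a` (`h ≠ h′`). [formal bookkeeping] -/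
theorem dipole_left (hne : h ≠ h') : dipole h h' a b h = a := by
  rw [dipole, pinField_of_mem (Finset.mem_insert_self h {h'})]; exact if_neg hne

/-- The dipole's row sum in closed form. [formal bookkeeping: `Finset.sum_pair`] -/
theorem sum_pair_dipole (hne : h ≠ h') (j : Fin M₀) :
    ∑ k ∈ ({h, h'} : Finset (Fin M₀)), H M₀ z₀ c₀ j k ((fun k => if k = h' then b else a) k) = H M₀ z₀ c₀ j h a + H M₀ z₀ c₀ j h' b := by
  rw [Finset.sum_pair hne]
  simp [hne]

/-- (DFEAS) is (WFEAS) of the dipole. [formal bookkeeping] -/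
theorem witnessFeasible_of_dipoleFeasible (hne : h ≠ h') (hD : DipoleFeasible τ σ H F Y z₀ c₀ O h h' a b) :
    WitnessFeasible τ σ H F Y z₀ c₀ O {h, h'} (fun k => if k = h' then b else a) :=
  fun j hj hs => by rw [sum_pair_dipole hne, ← add_assoc]; exact hD j hj hs

/-- ★ (DFEAS) is MONOTONE in the column; in particular feasible against `σ + X` ⇒ feasible against every priced column `addCol X P`, `P ≥ 0`.
[formal bookkeeping] -/
theorem DipoleFeasible.addCol (hP : ∀ j, 0 ≤ P M₀ z₀ c₀ j) (hD : DipoleFeasible τ σ H F X z₀ c₀ O h h' a b) :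
    DipoleFeasible τ σ H F (FrustratedLawDichotomyStrainedPatchRowPrice.addCol X P) z₀ c₀ O h h' a b :=
  fun j hj hs => (hD j hj hs).trans (by simp only [FrustratedLawDichotomyStrainedPatchRowPrice.addCol]; linarith [hP j])

/-- Near partners are distinct from the row and occupied; the dipole support lies in `O` and misses the centre. [formal bookkeeping] -/
theorem dipole_support (hh : h ∈ O) (hh' : h' ∈ hostNear r z₀ O h) (hhc : h ≠ c₀) (hh'c : h' ≠ c₀) :
    h ≠ h' ∧ ({h, h'} : Finset (Fin M₀)) ⊆ O ∧ c₀ ∉ ({h, h'} : Finset (Fin M₀)) := by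
  have hf := Finset.mem_filter.1 hh'
  refine ⟨fun hc => hf.2.1 hc.symm, fun k hk => ?_, fun hc => ?_⟩
  · rcases Finset.mem_insert.1 hk with rfl | hk
    · exact hh
    · rw [Finset.mem_singleton.1 hk]; exact hf.1
  · rcases Finset.mem_insert.1 hc with hc | hc
    · exact hhc hc.symm
    · exact hh'c (Finset.mem_singleton.1 hc).symm

/-- ★★★ **THE DIPOLE FLOOR** — on an instance of the family, an admissible occupancy, a maybe-reach row `h ≠ c₀` and a near partner `h′ ≠ c₀`: a
feasible dipole with `‖a‖, ‖b‖ ≤ τ` forces `‖b − a‖ ≤ G(h, h′)` for EVERY valid (HDIFF) table `G`. [formal bookkeeping: `diffTab_floor`] -/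
theorem diffTab_dipole_floor (hG : HostDiffTab 𝓘 τ σ r H F Y G) (hI : 𝓘 M₀ z₀ c₀) (hO : AdmOcc τ z₀ c₀ O) (hh : h ∈ O)
    (hm : HostMaybeReach τ z₀ c₀ O h) (hh' : h' ∈ hostNear r z₀ O h) (hhc : h ≠ c₀) (hh'c : h' ≠ c₀) (hτ : 0 ≤ τ) (ha : ‖a‖ ≤ τ) (hb : ‖b‖ ≤ τ)
    (hD : DipoleFeasible τ σ H F Y z₀ c₀ O h h' a b) : ‖b - a‖ ≤ G M₀ z₀ c₀ h h' := by
  obtain ⟨hne, hS, hc⟩ := dipole_support hh hh' hhc hh'c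
  have hu : ∀ k ∈ ({h, h'} : Finset (Fin M₀)), ‖(fun k => if k = h' then b else a) k‖ ≤ τ := fun k _ => by
    by_cases hk : k = h'
    · simp only [if_pos hk]; exact hb
    · simp only [if_neg hk]; exact ha
  have key := diffTab_floor hG hI hO hS hc hτ hu (witnessFeasible_of_dipoleFeasible hne hD) hh hm hh'
  have e₁ : pinField {h, h'} (fun k => if k = h' then b else a) h' = b := dipole_right
  have e₂ : pinField {h, h'} (fun k => if k = h' then b else a) h = a := dipole_left hne
  rwa [e₁, e₂] at key

/-- ★★★ **THE GRADED DIPOLE FLOOR** (under (HDIFF-G)): the same with `‖a‖ ≤ T(h)`, `‖b‖ ≤ T(h′)`, `T ≥ 0` on `O`. [formal bookkeeping: `diffTabG_floor`] -/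
theorem diffTabG_dipole_floor (hG : HostDiffTabG 𝓘 τ T σ r H F Y G) (hI : 𝓘 M₀ z₀ c₀) (hO : AdmOcc τ z₀ c₀ O) (hh : h ∈ O)
    (hm : HostMaybeReach τ z₀ c₀ O h) (hh' : h' ∈ hostNear r z₀ O h) (hhc : h ≠ c₀) (hh'c : h' ≠ c₀) (hτ : 0 ≤ τ) (ha : ‖a‖ ≤ τ) (hb : ‖b‖ ≤ τ)
    (hT : ∀ k ∈ O, 0 ≤ T M₀ z₀ c₀ k) (haT : ‖a‖ ≤ T M₀ z₀ c₀ h) (hbT : ‖b‖ ≤ T M₀ z₀ c₀ h') (hD : DipoleFeasible τ σ H F Y z₀ c₀ O h h' a b) :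
    ‖b - a‖ ≤ G M₀ z₀ c₀ h h' := by
  obtain ⟨hne, hS, hc⟩ := dipole_support hh hh' hhc hh'c
  have hu : ∀ k ∈ ({h, h'} : Finset (Fin M₀)), ‖(fun k => if k = h' then b else a) k‖ ≤ τ := fun k _ => by
    by_cases hk : k = h'
    · simp only [if_pos hk]; exact hb
    · simp only [if_neg hk]; exact ha
  have huT : ∀ k ∈ ({h, h'} : Finset (Fin M₀)), ‖(fun k => if k = h' then b else a) k‖ ≤ T M₀ z₀ c₀ k := fun k hk => by
    by_cases hk' : k = h'
    · simp only [if_pos hk']; rw [hk']; exact hbT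
    · simp only [if_neg hk']
      rcases Finset.mem_insert.1 hk with rfl | hk
      · exact haT
      · exact absurd (Finset.mem_singleton.1 hk) hk'
  have key := diffTabG_floor hG hI hO hS hc hτ hu hT huT (witnessFeasible_of_dipoleFeasible hne hD) hh hm hh'
  have e₁ : pinField {h, h'} (fun k => if k = h' then b else a) h' = b := dipole_right
  have e₂ : pinField {h, h'} (fun k => if k = h' then b else a) h = a := dipole_left hne
  rwa [e₁, e₂] at key

/-- `‖t′·e − (−(t·e))‖ = t + t′` for a unit vector and `t, t′ ≥ 0`. [formal bookkeeping] -/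
theorem norm_antiparallel {t t' : ℝ} (ht : 0 ≤ t) (ht' : 0 ≤ t') (he : ‖e‖ = 1) : ‖t' • e - -(t • e)‖ = t + t' := by
  rw [sub_neg_eq_add, ← add_smul, norm_smul, he, mul_one, Real.norm_of_nonneg (add_nonneg ht' ht), add_comm]

/-- ★★★ **STUCK AT THE BOX** — if the full-amplitude antiparallel dipole `(−τ·e, +τ·e)`, `‖e‖ = 1`, passes the row check, then NO valid (HDIFF)
table beats the box `2τ` at `(h, h′)`: the LP stage cannot move there, whatever its accuracy. [formal bookkeeping: `diffTab_dipole_floor`] -/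
theorem boxTab_le_of_dipoleFeasible (hG : HostDiffTab 𝓘 τ σ r H F Y G) (hI : 𝓘 M₀ z₀ c₀) (hO : AdmOcc τ z₀ c₀ O) (hh : h ∈ O)
    (hm : HostMaybeReach τ z₀ c₀ O h) (hh' : h' ∈ hostNear r z₀ O h) (hhc : h ≠ c₀) (hh'c : h' ≠ c₀) (hτ : 0 ≤ τ) (he : ‖e‖ = 1)
    (hD : DipoleFeasible τ σ H F Y z₀ c₀ O h h' (-(τ • e)) (τ • e)) : boxTab τ M₀ z₀ c₀ h h' ≤ G M₀ z₀ c₀ h h' := by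
  have hn : ‖τ • e‖ ≤ τ := by rw [norm_smul, he, mul_one, Real.norm_of_nonneg hτ]
  have key := diffTab_dipole_floor hG hI hO hh hm hh' hhc hh'c hτ (by rwa [norm_neg]) hn hD
  rw [norm_antiparallel hτ hτ he] at key
  simpa only [boxTab, two_mul] using key

/-- ★★★ **STUCK AT THE GRADED BOX** — the graded analogue with amplitudes `(T(h), T(h′))`, `T ≤ τ` at `h, h′` and `T ≥ 0` on `O`: no valid (HDIFF-G)
table beats `boxTabG T (h, h′) = T(h) + T(h′)`. [formal bookkeeping: `diffTabG_dipole_floor`] -/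
theorem boxTabG_le_of_dipoleFeasible (hG : HostDiffTabG 𝓘 τ T σ r H F Y G) (hI : 𝓘 M₀ z₀ c₀) (hO : AdmOcc τ z₀ c₀ O) (hh : h ∈ O)
    (hm : HostMaybeReach τ z₀ c₀ O h) (hh' : h' ∈ hostNear r z₀ O h) (hhc : h ≠ c₀) (hh'c : h' ≠ c₀) (hT : ∀ k ∈ O, 0 ≤ T M₀ z₀ c₀ k)
    (hTh : T M₀ z₀ c₀ h ≤ τ) (hTh' : T M₀ z₀ c₀ h' ≤ τ) (he : ‖e‖ = 1)
    (hD : DipoleFeasible τ σ H F Y z₀ c₀ O h h' (-(T M₀ z₀ c₀ h • e)) (T M₀ z₀ c₀ h' • e)) : boxTabG T M₀ z₀ c₀ h h' ≤ G M₀ z₀ c₀ h h' := by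
  have h0 : 0 ≤ T M₀ z₀ c₀ h := hT h hh
  have h0' : 0 ≤ T M₀ z₀ c₀ h' := hT h' (mem_of_mem_hostNear hh')
  have hτ : 0 ≤ τ := h0.trans hTh
  have n₁ : ‖T M₀ z₀ c₀ h • e‖ = T M₀ z₀ c₀ h := by rw [norm_smul, he, mul_one, Real.norm_of_nonneg h0]
  have n₂ : ‖T M₀ z₀ c₀ h' • e‖ = T M₀ z₀ c₀ h' := by rw [norm_smul, he, mul_one, Real.norm_of_nonneg h0']
  have key := diffTabG_dipole_floor hG hI hO hh hm hh' hhc hh'c hτ (by rw [norm_neg, n₁]; exact hTh) (by rw [n₂]; exact hTh') hT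
    (by rw [norm_neg, n₁]) (by rw [n₂]) hD
  rw [norm_antiparallel h0 h0' he] at key
  simpa only [boxTabG] using key

/-- ★★ **THE ACROSS-PAIR FLOOR** — a feasible dipole on `(h′, Pm h′)` bounds the across-pair table `G₁(h, h′)` of (HPAIR) from below. [formal bookkeeping] -/
theorem pairTab_dipole_floor (hG : HostPairTab 𝓘 τ σ r H F Y Pm G₁ G₂) (hPm : PairAdm r Pm) (hI : 𝓘 M₀ z₀ c₀) (hO : AdmOcc τ z₀ c₀ O)
    (hh : h ∈ O) (hm : HostMaybeReach τ z₀ c₀ O h) (hh' : h' ∈ hostNear r z₀ O h) (hne : Pm M₀ z₀ c₀ O h h' ≠ h')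
    (hh'c : h' ≠ c₀) (hh''c : Pm M₀ z₀ c₀ O h h' ≠ c₀) (hτ : 0 ≤ τ) (ha : ‖a‖ ≤ τ) (hb : ‖b‖ ≤ τ)
    (hD : DipoleFeasible τ σ H F Y z₀ c₀ O (Pm M₀ z₀ c₀ O h h') h' a b) : ‖b - a‖ ≤ G₁ M₀ z₀ c₀ h h' := by
  set h'' := Pm M₀ z₀ c₀ O h h' with hdef
  have hh''n : h'' ∈ hostNear r z₀ O h := (hPm M₀ z₀ c₀ O h h' hh').1
  have hS : ({h'', h'} : Finset (Fin M₀)) ⊆ O := fun k hk => by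
    rcases Finset.mem_insert.1 hk with rfl | hk
    · exact mem_of_mem_hostNear hh''n
    · rw [Finset.mem_singleton.1 hk]; exact mem_of_mem_hostNear hh'
  have hc : c₀ ∉ ({h'', h'} : Finset (Fin M₀)) := fun hc => by
    rcases Finset.mem_insert.1 hc with hc | hc
    · exact hh''c hc.symm
    · exact hh'c (Finset.mem_singleton.1 hc).symm
  have hu : ∀ k ∈ ({h'', h'} : Finset (Fin M₀)), ‖(fun k => if k = h' then b else a) k‖ ≤ τ := fun k _ => by
    by_cases hk : k = h'
    · simp only [if_pos hk]; exact hb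
    · simp only [if_neg hk]; exact ha
  have key := (pairTab_floor hG hI hO hS hc hτ hu (witnessFeasible_of_dipoleFeasible hne hD) hh hm hh').1
  have e₁ : pinField {h'', h'} (fun k => if k = h' then b else a) h' = b := dipole_right
  have e₂ : pinField {h'', h'} (fun k => if k = h' then b else a) h'' = a := dipole_left hne
  rw [← hdef, e₁, e₂] at key
  exact key

end Dipole

/-! ## §4. The price floor: certified evaluations are bounded below by the evaluation of any entrywise floor -/

section Price

variable {𝓘 : ChartFam} {τ r : ℝ} {B : E3 → E3 →L[ℝ] E3 →L[ℝ] E3} {tl : ℝ → ℝ → ℝ} {T P : SlackTab} {G Gf : DiffTab} {M₀ : ℕ} {z₀ : Fin M₀ → E3}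
  {c₀ : Fin M₀} {O : Finset (Fin M₀)} {D : Fin M₀ → E3} {h : Fin M₀}

/-- ★ `diffEval` is MONOTONE in the table on the near set (`0 ≤ g ≤ g′`, `T` monotone). [formal bookkeeping] -/
theorem diffEval_mono (hT : TMono tl) {g g' : Fin M₀ → ℝ} (h0 : ∀ h' ∈ hostNear r z₀ O h, 0 ≤ g h') (hle : ∀ h' ∈ hostNear r z₀ O h, g h' ≤ g' h') :
    diffEval B tl r z₀ O g h ≤ diffEval B tl r z₀ O g' h := by
  unfold diffEval
  refine add_le_add (mul_le_mul_of_nonneg_left (Finset.sum_le_sum fun h' hh' => ?_) (by norm_num)) (Finset.sum_le_sum fun h' hh' => ?_)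
  · exact mul_le_mul_of_nonneg_left (pow_le_pow_left₀ (h0 h' hh') (hle h' hh') 2) (norm_nonneg (B (z₀ h' - z₀ h)))
  · exact hT _ _ _ (h0 h' hh') (hle h' hh')

/-- ★★ **THE PRICE FLOOR** — if the census certifies `(DEVAL) diffEval(G) ≤ P` on a (graded) reading and `Gf ≤ G` entrywise on the near set of the
maybe-reach row `h` with `Gf ≥ 0` (e.g. `Gf(h, h′) = ‖b − a‖` of feasible dipoles, §3), then `diffEval(Gf)(h) ≤ P(h)`: every certified stage price is
bounded BELOW by the closed-form evaluation of the floor table. [formal bookkeeping: `diffEval_mono`] -/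
theorem diffEval_floor_le_price (hT : TMono tl) (hP : DiffEvalTabG 𝓘 τ T B tl r G P) (hI : 𝓘 M₀ z₀ c₀) (hR : HostReadingG τ T z₀ c₀ O D)
    (hh : h ∈ O) (hm : HostMaybeReach τ z₀ c₀ O h) (h0 : ∀ h' ∈ hostNear r z₀ O h, 0 ≤ Gf M₀ z₀ c₀ h h')
    (hle : ∀ h' ∈ hostNear r z₀ O h, Gf M₀ z₀ c₀ h h' ≤ G M₀ z₀ c₀ h h') : diffEval B tl r z₀ O (Gf M₀ z₀ c₀ h) h ≤ P M₀ z₀ c₀ h :=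
  (diffEval_mono hT h0 hle).trans (hP M₀ z₀ c₀ hI O D hR h hh hm)

/-- The same under the (DEVAL) format of record (`GradStep`). [formal bookkeeping] -/
theorem diffEval_floor_le_price' (hT : TMono tl) (hP : DiffEvalTab 𝓘 τ B tl r G P) (hI : 𝓘 M₀ z₀ c₀) (hR : HostReading τ z₀ c₀ O D)
    (hh : h ∈ O) (hm : HostMaybeReach τ z₀ c₀ O h) (h0 : ∀ h' ∈ hostNear r z₀ O h, 0 ≤ Gf M₀ z₀ c₀ h h')
    (hle : ∀ h' ∈ hostNear r z₀ O h, Gf M₀ z₀ c₀ h h' ≤ G M₀ z₀ c₀ h h') : diffEval B tl r z₀ O (Gf M₀ z₀ c₀ h) h ≤ P M₀ z₀ c₀ h :=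
  (diffEval_mono hT h0 hle).trans (hP M₀ z₀ c₀ hI O D hR h hh hm)

end Price

end Summit.AtomisticToContinuum.Crystallization.Theorems.FrustratedLawDichotomyStrainedPatchTableFloors
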